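import Mathlib
import Summits.MatrixMultiplication.MatrixMultiplication.Theorems.SoloBlindCorankLeFour
import Summits.MatrixMultiplication.MatrixMultiplication.Theorems.SoloBlindCorankOne

/-!
# (K₃) and Conjecture E at corank at most four — rank form

Sub-programme (K₃) / Conjecture E.  `SoloBlindCorankLeFour` proves `K(τ; S) ≤ 1` (and `E(τ; S) ≤ 1/2` for H-good `τ`)
for a zero-sum-free family `h` on `S = B ∪ X` with `B` subset-sum-distinct and `|X| ≤ 4`.  This file restates the
result in the language of linear algebra: for an indexed family `h : ι → G` in a `ZMod 3`-module (repeated values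
allowed) that is zero-sum free on `S` and has CORANK at most four,
`|S| ≤ dim span h(S) + 4`, every target has Kraft mass at most `1`, and every H-good target at most `1/2`.

* `soloBlind_coeffIndep_of_linearIndepOn` — `LinearIndepOn` on `↑B` gives the coefficient form of independence used by
  `soloBlind_sumDistinct_of_linearIndependent`.
* `soloBlind_exists_indepOn_spanning` — inside `S` there is a `B` on which `h` is linearly independent with
  `dim span h(S) ≤ |B|` (a maximal independent subfamily).
* `soloBlind_kraft_rank_add_four`, `soloBlind_conjE_rank_add_four` — the rank forms.
-/

namespace Summit.MatrixMultiplication.MatrixMultiplication.Theorems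

open Finset

universe u

variable {ι : Type*} [DecidableEq ι]
variable {G : Type u} [AddCommGroup G] [DecidableEq G]

omit [DecidableEq ι] [DecidableEq G] in
/-- `LinearIndepOn R h ↑B` yields the coefficient form: a vanishing `R`-combination over `B` has all its
coefficients on `B` equal to zero. -/
theorem soloBlind_coeffIndep_of_linearIndepOn {R : Type*} [Ring R] [Module R G] {h : ι → G} {B : Finset ι}
    (hli : LinearIndepOn R h (↑B : Set ι)) :
    ∀ g : ι → R, ∑ i ∈ B, g i • h i = 0 → ∀ i ∈ B, g i = 0 := by
  intro g hg i hi
  have hli' : LinearIndependent R (fun b : B => h b) := hli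
  have h0 : ∑ b : B, (fun b : B => g b) b • h b = 0 := by
    rw [Finset.sum_coe_sort B (fun i => g i • h i)]
    exact hg
  exact Fintype.linearIndependent_iff.1 hli' (fun b : B => g b) h0 ⟨i, hi⟩

omit [DecidableEq ι] [DecidableEq G] in
/-- Inside a finite index set `S` there is a subset `B` on which `h` is linearly independent and whose size bounds
the dimension of the span of `h '' S` (a maximal independent subfamily spans). -/
theorem soloBlind_exists_indepOn_spanning [Module (ZMod 3) G] (h : ι → G) (S : Finset ι) :
    ∃ B ⊆ S, LinearIndepOn (ZMod 3) h (↑B : Set ι) ∧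
      Module.finrank (ZMod 3) (Submodule.span (ZMod 3) (h '' (↑S : Set ι))) ≤ B.card := by
  classical
  obtain ⟨b, hbS, -, hspan, hli⟩ := exists_linearIndepOn_extension (K := ZMod 3) (v := h)
    (linearIndepOn_empty (ZMod 3) h) (Set.empty_subset (↑S : Set ι))
  have hbfin : b.Finite := S.finite_toSet.subset hbS
  refine ⟨hbfin.toFinset, ?_, ?_, ?_⟩
  · intro i hi
    exact hbS (hbfin.mem_toFinset.1 hi)
  · rw [hbfin.coe_toFinset]
    exact hli
  · have hBcoe : (↑hbfin.toFinset : Set ι) = b := hbfin.coe_toFinset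
    have h1 : Submodule.span (ZMod 3) (h '' (↑S : Set ι))
        ≤ Submodule.span (ZMod 3) (↑(hbfin.toFinset.image h) : Set G) := by
      rw [Finset.coe_image, hBcoe]
      exact Submodule.span_le.mpr hspan
    calc Module.finrank (ZMod 3) (Submodule.span (ZMod 3) (h '' (↑S : Set ι)))
        ≤ Module.finrank (ZMod 3) (Submodule.span (ZMod 3) (↑(hbfin.toFinset.image h) : Set G)) :=
          Submodule.finrank_mono h1
      _ ≤ (hbfin.toFinset.image h).card := finrank_span_finset_le_card _
      _ ≤ hbfin.toFinset.card := Finset.card_image_le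

/-- (K₃) AT CORANK AT MOST FOUR, RANK FORM: in a `ZMod 3`-module, a family `h` that is zero-sum free on `S` with
`|S| ≤ dim span h(S) + 4` has Kraft mass `K(τ; S) ≤ 1` at every target. -/
theorem soloBlind_kraft_rank_add_four [Module (ZMod 3) G] {h : ι → G} {S : Finset ι}
    (hc : S.card ≤ Module.finrank (ZMod 3) (Submodule.span (ZMod 3) (h '' (↑S : Set ι))) + 4)
    (zsf : ∀ T ⊆ S, T.Nonempty → ∑ i ∈ T, h i ≠ 0) (τ : G) : soloBlindMass h S τ ≤ 1 := by
  obtain ⟨B, hBS, hli, hrank⟩ := soloBlind_exists_indepOn_spanning h S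
  have hcB : (S \ B).card ≤ 4 := by
    rw [Finset.card_sdiff_of_subset hBS]
    omega
  exact soloBlind_kraft_corank_le_four soloBlind_three_of_module hBS hcB
    (soloBlind_sumDistinct_of_linearIndependent (R := ZMod 3) (soloBlind_coeffIndep_of_linearIndepOn hli))
    zsf τ

/-- CONJECTURE E AT CORANK AT MOST FOUR, RANK FORM: in a `ZMod 3`-module, a family `h` that is zero-sum free on `S`
with `|S| ≤ dim span h(S) + 4` has `E(τ; S) ≤ 1/2` at every H-good target `τ`. -/
theorem soloBlind_conjE_rank_add_four [Module (ZMod 3) G] {h : ι → G} {S : Finset ι}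
    (hc : S.card ≤ Module.finrank (ZMod 3) (Submodule.span (ZMod 3) (h '' (↑S : Set ι))) + 4)
    (zsf : ∀ T ⊆ S, T.Nonempty → ∑ i ∈ T, h i ≠ 0) {τ : G} (hgood : ∀ T ⊆ S, ∑ i ∈ T, h i ≠ τ + τ) :
    soloBlindMass h S τ ≤ 1 / 2 := by
  obtain ⟨B, hBS, hli, hrank⟩ := soloBlind_exists_indepOn_spanning h S
  have hcB : (S \ B).card ≤ 4 := by
    rw [Finset.card_sdiff_of_subset hBS]
    omega
  exact soloBlind_conjE_corank_le_four soloBlind_three_of_module hBS hcB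
    (soloBlind_sumDistinct_of_linearIndependent (R := ZMod 3) (soloBlind_coeffIndep_of_linearIndepOn hli))
    zsf hgood

end Summit.MatrixMultiplication.MatrixMultiplication.Theorems
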